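import Mathlib.Tactic.Linarith
import Mathlib.Tactic.LinearCombination
import Summits.CriticalPhenomena.PercolationContinuityZ3.Theorems.PercNearOneGluingNoHeavyLowerTailSahiCTCForms
import HarnessLib

/-!
# `NoHeavyLowerTail` (crux stmt-CriticalPhenomena-4575), P3 lane: the EDGE MOVE (M1) of the reduction theorem (memo g17 §1.3) for the all-live
# closed forms `G022`, `G122`, `G222 = Ñ₂`

Support file (seat `prim-l12-p3`, gen 18; `--supports stmt-CriticalPhenomena-4575`).  Companion of `…SahiCTCForms` (dictionary, forms, the face
move (M2)).  Memo `run/shared/lean/prim/prim-l12/FROM-prim-l12-p3-g17-REDUCTION-TO-3-COLOURINGS.md` §1.3 (M1):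
removing from `K_X` an edge `a ∈ K_X` that is NOT an edge of `K_Z` changes `Q` (hence `G022`, and `G122`, `G222` with the factors `e₁`, `e₂`) by
`r^a·(Π·Θ₁ + Π·E_Z + D·(Π − ε̄_Z − t̄_Z))` — `ε̄_X` and `ω` gain `r^a`, and `Π² − (Π+D)ε̄_Z − D·t̄_Z = Π·Θ₁ + Π·(e₂ − ε̄_Z) + D·(Π − ε̄_Z − t̄_Z)` —
a polynomial with manifestly nonnegative coefficients.  Hence (`coeff_forms_le_erase_edge`) the three forms can only go UP coefficientwise under
the move; read backwards, giving a common non-edge to one side LOWERS the forms, so nonnegativity proofs may assume `ω = ∅`.  With (M2) of the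
companion file this is memo g17 Theorem 1.3; the iteration to 'flag complexes with no common non-edge' is bookkeeping left to the user.
Nothing is asserted about the crux; no positivity of the forms themselves is claimed.
-/

namespace Summit.CriticalPhenomena.PercolationContinuityZ3.Theorems.SahiCTCForms

open Finset MvPolynomial SahiCTCGenFun

variable {α : Type*} [DecidableEq α] [Fintype α]

/-! ### The reduction theorem's edge move (M1) (memo g17 §1.3): removing from `K_X` an edge that is not an edge of `K_Z` -/

/-- The edges (2-faces) of a complex. [this work] -/
def edgesOf (K : Finset (Finset α)) : Finset (Finset α) := univ.powerset.filter fun S => #S = 2 ∧ S ∈ K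

/-- The sets that are small (`#S ≤ 1`) or faces of `K`: the complement of `ε̄_K ⊔ t̄_K` (`Π − ε̄_K − t̄_K`; equals `GF(K)` when `K` contains all
sets of size ≤ 1). [this work] -/
def lowOrFace (K : Finset (Finset α)) : Finset (Finset α) := univ.powerset.filter fun S => #S ≤ 1 ∨ S ∈ K

/-- `e₂ = GF(edges of K) + ε̄_K`. [this work] -/
theorem ee_two_eq_edges (K : Finset (Finset α)) : (ee 2 : MvPolynomial α ℤ) = gf (edgesOf K) + gf (nonEdges K) := by
  have hU : (bySize (· = 2) : Finset (Finset α)) = edgesOf K ∪ nonEdges K := by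
    ext S; simp only [bySize, edgesOf, nonEdges, mem_filter, mem_union]; tauto
  have hD : Disjoint (edgesOf K) (nonEdges K) := by
    rw [disjoint_left]; intro S h1 h2; simp only [edgesOf, nonEdges, mem_filter] at h1 h2; tauto
  unfold ee; rw [hU, gf_union hD]

/-- `Π = ε̄_K + t̄_K + GF(lowOrFace K)`. [this work] -/
theorem PiP_eq_nonFaces (K : Finset (Finset α)) : (PiP : MvPolynomial α ℤ) = gf (nonEdges K) + gf (bigNonFaces K) + gf (lowOrFace K) := by
  have hU : (univ.powerset : Finset (Finset α)) = (nonEdges K ∪ bigNonFaces K) ∪ lowOrFace K := by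
    ext S; simp only [nonEdges, bigNonFaces, lowOrFace, mem_filter, mem_union, mem_powerset]
    constructor
    · intro hS
      by_cases hK : S ∈ K
      · exact Or.inr ⟨hS, Or.inr hK⟩
      · rcases Nat.lt_or_ge #S 2 with h | h
        · exact Or.inr ⟨hS, Or.inl (by omega)⟩
        · rcases Nat.lt_or_ge #S 3 with h' | h'
          · exact Or.inl (Or.inl ⟨hS, by omega, hK⟩)
          · exact Or.inl (Or.inr ⟨hS, h', hK⟩)
    · rintro ((⟨hS, _⟩ | ⟨hS, _⟩) | ⟨hS, _⟩) <;> exact hS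
  have hD1 : Disjoint (nonEdges K) (bigNonFaces K) := by
    rw [disjoint_left]; intro S h1 h2; simp only [nonEdges, bigNonFaces, mem_filter] at h1 h2; omega
  have hD2 : Disjoint (nonEdges K ∪ bigNonFaces K) (lowOrFace K) := by
    rw [disjoint_left]; intro S h1 h2
    simp only [nonEdges, bigNonFaces, lowOrFace, mem_filter, mem_union] at h1 h2
    rcases h1 with ⟨_, h, h'⟩ | ⟨_, h, h'⟩ <;> rcases h2 with ⟨_, h2 | h2⟩ <;> first | omega | exact h' h2
  unfold PiP; rw [hU, gf_union hD2, gf_union hD1]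

/-- `Π = Θ₁ + e₂ + D` (partition by size). [this work] -/
theorem PiP_eq_sizes : (PiP : MvPolynomial α ℤ) = Th1 + ee 2 + Dd := by
  have hU : (univ.powerset : Finset (Finset α)) = (bySize (· ≤ 1) ∪ bySize (· = 2)) ∪ bySize (3 ≤ ·) := by
    ext S; simp only [bySize, mem_filter, mem_union, mem_powerset]
    constructor
    · intro hS
      rcases Nat.lt_or_ge #S 2 with h | h
      · exact Or.inl (Or.inl ⟨hS, by omega⟩)
      · rcases Nat.lt_or_ge #S 3 with h' | h'
        · exact Or.inl (Or.inr ⟨hS, by omega⟩)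
        · exact Or.inr ⟨hS, h'⟩
    · rintro ((⟨hS, _⟩ | ⟨hS, _⟩) | ⟨hS, _⟩) <;> exact hS
  have hD1 : Disjoint (bySize (· ≤ 1) : Finset (Finset α)) (bySize (· = 2)) := by
    rw [disjoint_left]; intro S h1 h2; simp only [bySize, mem_filter] at h1 h2; omega
  have hD2 : Disjoint (bySize (· ≤ 1) ∪ bySize (· = 2) : Finset (Finset α)) (bySize (3 ≤ ·)) := by
    rw [disjoint_left]; intro S h1 h2; simp only [bySize, mem_filter, mem_union] at h1 h2; omega
  unfold PiP Th1 ee Dd; rw [hU, gf_union hD2, gf_union hD1]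

/-- Removing a 2-set from `K_X` does not change `t̄_X`. [this work] -/
theorem bigNonFaces_erase_edge {KX : Finset (Finset α)} {a : Finset α} (ha : #a = 2) : bigNonFaces (KX.erase a) = bigNonFaces KX := by
  ext S; simp only [bigNonFaces, mem_filter, mem_erase, ne_eq]
  constructor
  · rintro ⟨h1, h2, h3⟩; exact ⟨h1, h2, fun h => h3 ⟨by rintro rfl; omega, h⟩⟩
  · rintro ⟨h1, h2, h3⟩; exact ⟨h1, h2, fun h => h3 h.2⟩

/-- Removing an edge `a ∈ K_X` adds exactly `a` to `ε̄_X`. [this work] -/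
theorem nonEdges_erase_edge {KX : Finset (Finset α)} {a : Finset α} (haK : a ∈ KX) (ha : #a = 2) :
    nonEdges (KX.erase a) = insert a (nonEdges KX) ∧ a ∉ nonEdges KX := by
  refine ⟨?_, fun h => (mem_filter.1 h).2.2 haK⟩
  ext S; simp only [nonEdges, mem_filter, mem_erase, mem_insert, mem_powerset, ne_eq]
  constructor
  · rintro ⟨h1, h2, h3⟩
    by_cases hS : S = a
    · exact Or.inl hS
    · exact Or.inr ⟨h1, h2, fun h => h3 ⟨hS, h⟩⟩
  · rintro (rfl | ⟨h1, h2, h3⟩)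
    · exact ⟨subset_univ _, ha, fun h => h.1 rfl⟩
    · exact ⟨h1, h2, fun h => h3 h.2⟩

/-- Removing an edge `a ∈ K_X` with `a ∉ K_Z`: `ω` gains `a`, `η` and `E_Y` are unchanged. [this work] -/
theorem pairFamilies_erase_edge {KX KZ : Finset (Finset α)} {a : Finset α} (haK : a ∈ KX) (haZ : a ∉ KZ) (ha : #a = 2) :
    (omega (KX.erase a) KZ = insert a (omega KX KZ) ∧ a ∉ omega KX KZ) ∧ eta (KX.erase a) KZ = eta KX KZ ∧
      commonEdges (KX.erase a) KZ = commonEdges KX KZ := by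
  refine ⟨⟨?_, fun h => (mem_filter.1 h).2.2.1 haK⟩, ?_, ?_⟩
  · ext S; simp only [omega, mem_filter, mem_erase, mem_insert, mem_powerset, ne_eq]
    constructor
    · rintro ⟨h1, h2, h3, h4⟩
      by_cases hS : S = a
      · exact Or.inl hS
      · exact Or.inr ⟨h1, h2, fun h => h3 ⟨hS, h⟩, h4⟩
    · rintro (rfl | ⟨h1, h2, h3, h4⟩)
      · exact ⟨subset_univ _, ha, fun h => h.1 rfl, haZ⟩
      · exact ⟨h1, h2, fun h => h3 h.2, h4⟩
  · ext S; simp only [eta, mem_filter, mem_erase, ne_eq]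
    constructor
    · rintro ⟨h1, h2, h3⟩
      by_cases hS : S = a
      · subst hS; exact ⟨h1, h2, Or.inr haZ⟩
      · exact ⟨h1, h2, h3.imp (fun h h' => h ⟨hS, h'⟩) id⟩
    · rintro ⟨h1, h2, h3⟩; exact ⟨h1, h2, h3.imp (fun h h' => h h'.2) id⟩
  · ext S; simp only [commonEdges, mem_filter, mem_erase, ne_eq]
    constructor
    · rintro ⟨h1, h2, h3, h4⟩; exact ⟨h1, h2, h3.2, h4⟩
    · rintro ⟨h1, h2, h3, h4⟩
      exact ⟨h1, h2, ⟨by rintro rfl; exact haZ h4, h3⟩, h4⟩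

/-- **(M1) for `Q`**: removing from `K_X` an edge `a ∈ K_X`, `a ∉ K_Z` changes `Q` by `r^a·(Π·Θ₁ + Π·E_Z + D·(Π − ε̄_Z − t̄_Z))` (memo g17 §1.3 (M1):
`[ε̄_X and ω gain r^a; Π² − (Π+D)ε̄_Z − Dt̄_Z = ΠΘ₁ + Π(e₂−ε̄_Z) + D(Π−ε̄_Z−t̄_Z)]`), manifestly with nonnegative coefficients. [this work] -/
theorem Q_erase_edge {KX KZ : Finset (Finset α)} {a : Finset α} (haK : a ∈ KX) (haZ : a ∉ KZ) (ha : #a = 2) :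
    Q (KX.erase a) KZ = Q KX KZ + monomial (ind a) 1 * (PiP * Th1 + PiP * gf (edgesOf KZ) + Dd * gf (lowOrFace KZ)) := by
  obtain ⟨⟨h1, h2⟩, _, _⟩ := pairFamilies_erase_edge (KZ := KZ) haK haZ ha
  obtain ⟨h3, h4⟩ := nonEdges_erase_edge haK ha
  have hgω : gf (omega (KX.erase a) KZ) = gf (omega KX KZ) + monomial (ind a) 1 := by
    rw [h1]; unfold gf; rw [sum_insert h2, add_comm]
  have hgε : gf (nonEdges (KX.erase a)) = gf (nonEdges KX) + monomial (ind a) 1 := by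
    rw [h3]; unfold gf; rw [sum_insert h4, add_comm]
  have hL1 := ee_two_eq_edges (α := α) KZ
  have hL2 := PiP_eq_nonFaces (α := α) KZ
  have hL3 := PiP_eq_sizes (α := α)
  have hDd : (Dd : MvPolynomial α ℤ) = gf (bigNonFaces KZ) + gf (lowOrFace KZ) - Th1 - gf (edgesOf KZ) := by
    linear_combination hL2 - hL3 - hL1
  unfold Q
  rw [bigNonFaces_erase_edge ha, hgω, hgε, hDd, hL2]
  ring

/-- **(M1) for the three forms**, with the manifestly nonnegative increment `c_F·r^a·(Π·Θ₁ + Π·E_Z + D·(Π − ε̄_Z − t̄_Z))`, `c_F = 1, e₁, e₂`. [this work] -/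
theorem forms_erase_edge {KX KZ : Finset (Finset α)} {a : Finset α} (haK : a ∈ KX) (haZ : a ∉ KZ) (ha : #a = 2) :
    G022 (KX.erase a) KZ = G022 KX KZ + monomial (ind a) 1 * (PiP * Th1 + PiP * gf (edgesOf KZ) + Dd * gf (lowOrFace KZ)) ∧
    G122 (KX.erase a) KZ = G122 KX KZ + ee 1 * monomial (ind a) 1 * (PiP * Th1 + PiP * gf (edgesOf KZ) + Dd * gf (lowOrFace KZ)) ∧
    G222 (KX.erase a) KZ = G222 KX KZ + ee 2 * monomial (ind a) 1 * (PiP * Th1 + PiP * gf (edgesOf KZ) + Dd * gf (lowOrFace KZ)) := by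
  obtain ⟨_, h4, _⟩ := pairFamilies_erase_edge (KZ := KZ) haK haZ ha
  refine ⟨?_, ?_, ?_⟩
  · unfold G022; rw [Q_erase_edge haK haZ ha]; ring
  · unfold G122; rw [Q_erase_edge haK haZ ha, h4]; ring
  · unfold G222; rw [Q_erase_edge haK haZ ha, h4]; ring

/-- The (M1) increment has nonnegative coefficients (sums of products of generating functions). [this work] -/
theorem coeff_edgeBracket_nonneg (KZ : Finset (Finset α)) (n : α →₀ ℕ) :
    0 ≤ (PiP * Th1 + PiP * gf (edgesOf KZ) + Dd * gf (lowOrFace KZ) : MvPolynomial α ℤ).coeff n := by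
  unfold PiP Th1 Dd
  rw [coeff_add, coeff_add]
  have h1 := coeff_mul_nonneg (coeff_gf_nonneg (univ.powerset : Finset (Finset α))) (coeff_gf_nonneg (bySize (· ≤ 1))) n
  have h2 := coeff_mul_nonneg (coeff_gf_nonneg (univ.powerset : Finset (Finset α))) (coeff_gf_nonneg (edgesOf KZ)) n
  have h3 := coeff_mul_nonneg (coeff_gf_nonneg (bySize (3 ≤ ·) : Finset (Finset α))) (coeff_gf_nonneg (lowOrFace KZ)) n
  linarith

/-- **THE EDGE MOVE OF THE REDUCTION THEOREM (memo g17 §1.3 (M1))**: removing from `K_X` an edge that is not an edge of `K_Z` raises `G022`, `G122`,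
`G222 = Ñ₂` COEFFICIENTWISE (no hypothesis on `K_Z`).  Read backwards: giving a common non-edge to one of the two complexes lowers the forms, so a
proof of their nonnegativity may assume the pair has no common non-edge (`ω = ∅`). [this work] -/
theorem coeff_forms_le_erase_edge {KX KZ : Finset (Finset α)} {a : Finset α} (haK : a ∈ KX) (haZ : a ∉ KZ) (ha : #a = 2) (n : α →₀ ℕ) :
    (G022 KX KZ).coeff n ≤ (G022 (KX.erase a) KZ).coeff n ∧ (G122 KX KZ).coeff n ≤ (G122 (KX.erase a) KZ).coeff n ∧
      (G222 KX KZ).coeff n ≤ (G222 (KX.erase a) KZ).coeff n := by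
  obtain ⟨h0, h1, h2⟩ := forms_erase_edge (KZ := KZ) haK haZ ha
  have hM : ∀ m, 0 ≤ (monomial (ind a) (1 : ℤ) * (PiP * Th1 + PiP * gf (edgesOf KZ) + Dd * gf (lowOrFace KZ))).coeff m :=
    coeff_monomial_mul_nonneg a (coeff_edgeBracket_nonneg KZ)
  refine ⟨?_, ?_, ?_⟩
  · rw [h0, coeff_add]; linarith [hM n]
  · rw [h1, mul_assoc, coeff_add]
    have := coeff_mul_nonneg (P := ee 1) (fun m => by unfold ee; exact coeff_gf_nonneg _ m) hM n
    linarith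
  · rw [h2, mul_assoc, coeff_add]
    have := coeff_mul_nonneg (P := ee 2) (fun m => by unfold ee; exact coeff_gf_nonneg _ m) hM n
    linarith

end Summit.CriticalPhenomena.PercolationContinuityZ3.Theorems.SahiCTCForms
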